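import Literature.NumberTheory.LFunctions.TruncatedWeilFormFiniteDictionary
import Literature.NumberTheory.LFunctions.TruncatedWeilFormTailDensityRepr
import Literature.NumberTheory.LFunctions.TruncatedWeilFormZeroSideProofs
import Literature.NumberTheory.LFunctions.WeilExplicitBombieriLipschitz
import HarnessLib

/-!
# RH-FREE — «nothing here bears on the truth of RH»: the archimedean block of Groskin's entry identification (arXiv:2607.02828, Lemma 2.1) — `Q_arch,∞` is `−W♯_ℝ` of the Connes–Consani–Moscovici assembly

LINE 1 — LABEL: RH-FREE literature (unconditional identities between two printed forms of the
archimedean distribution of the explicit formula, evaluated on the trigonometric kernels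
`q(U_m,U_n)`; no positivity statement, no input on the zeros of `ζ`). Cell `rh-crit/cc` (surplus
seat, Groskin cluster, lead rulings R153/R161), fleet debt on the rung W-C/W-P (COLUMN 2 WEIL).
WHAT THIS IS NOT: any claim about the zeros of `ζ`, Weil positivity or RH; a kernel replay of a
dictionary lemma of an unrefereed preprint moves nothing. Nothing here bears on the truth of RH.

Topic `Literature/NumberTheory/LFunctions`; namespace `Literature.NumberTheory.LFunctions.Groskin2026`,
sub-namespace `ArchBlock`. THEOREMS ONLY (no definitions, no named facts). Discharges the claim
`Groskin2026.lemma_2_1_arch` of `TruncatedWeilFormFiniteDictionary.lean` (rh-lit-frontier-1 g2):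
for `c > 1`, `N`, `m, n ∈ I_N`, `(Q_arch,T)_{mn} → −W♯_ℝ(q(U_m,U_n)∘log)` as `T → ∞`, where
`W♯_ℝ` is [CCM] (3.15) in the form (4.4), the tree's `ConnesConsani2025.archSharp`, and `q(U_m,U_n)` is
the tree's kernel `ConnesConsani2025.qKer` ([claim: Groskin2026, status: under-review] record,
D-0012: a kernel proof VERIFIES it, asserts nothing on authority).

## The printed reason and how it is followed

[Gr26] Lemma 2.1 (p. 4), proof: «For the archimedean block, `h₊` is the standard archimedean density
of the explicit formula for the completed zeta function, i.e. the density of `W_ℝ` in [10, Sec. 3] and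
[8, Eq. (153)]; the entrywise `T`-limit exists because at integer nodes `S(r,n,L) = O(r⁻²)` and
`∂ₓS(r,x,L)|_{x=n} = O(r⁻²)` uniformly on `I_N` … while `h₊(r) = O(log r)`.» We make both halves
explicit:

* (E) ENTRYWISE FOURIER FORM `(Q_arch,T)_{mn} = (1/2π)∫_{−T}^{T} h₊(r) C_{mn}(r) dr`,
  `C_{mn}(r) = ∫₀ᴸ q(U_m,U_n)(y) cos(ry) dy` (`archMatrix_apply_eq_integral`): the divided differences
  of the source `x ↦ sin(2πx(1 − y/L))` at integer nodes are `π q(U_m,U_n)(y)` ([CvS] Prop. 4.1 /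
  [CCM] Lemma 2.3, tree `qKer_of_ne`, `qKer_self`); the diagonal is the derivative of the true source
  (cc-t18's `hasDerivAt_archSource`).
* (D) DECAY `|C_{mn}(r)| ≤ K/(1 + r²)` (`exists_abs_kernelCos_le`): two integrations by parts, the
  kernel being smooth on `[0, L]` and vanishing at `y = L`.
* (L) LIMIT: with `|h₊(r)| ≤ A + log(1+|r|)` (cc-t6's toolkit via `ZeroSide.abs_reDigammaQuarter_le_log`)
  the integrand is integrable on `ℝ`, so `(Q_arch,T)_{mn} → (1/2π)∫_ℝ h₊ C_{mn}` (`tendsto_archMatrix`).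
* (V) VALUE `(1/2π)∫_ℝ h₊ C_{mn} = −W♯_ℝ(q(U_m,U_n))` (`integral_hPlus_kernelCos`): with the EVEN
  kernel `G = q(U_m,U_n)(|·|)·1_{[−L,L]}` (the tree's `ConnesVanSuijlekom.symAutocorr L m n`),
  `Ĝ(½ + ir) = 2C_{mn}(r)`, Fourier inversion at `0` gives `∫_ℝ C_{mn} = π G(0)`, hence
  `(1/2π)∫ h₊ C_{mn} = ½ W_∞(G)` in the DIGAMMA form (tree `weilArchTerm`); Bombieri's form equals
  the digamma form for continuous compactly supported LIPSCHITZ test functions (tree theorem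
  `weilArchTermBombieri_eq_weilArchTerm_of_lipschitz`, Bombieri 2000 (2.8)); for an even `G`,
  Bombieri's form is `−2 W♯_ℝ(G)` by the very definition (3.15) (tree `psiSharpArch`, "note the
  factor ½"); and `W♯_ℝ(symAutocorr L m n) = archSharp L (qKer L m n)` is the tree theorem
  `psiSharpArch_symAutocorr` ([CCM] (4.4)).
* `Groskin2026.lemma_2_1_arch_holds : lemma_2_1_arch` (namespace `Groskin2026`, outside `ArchBlock`)
  assembles (L) and (V); axioms `propext`, `Classical.choice`, `Quot.sound`.

## References

* [Gr26] A. Groskin, arXiv:2607.02828v3 (2026), Lemma 2.1 and its proof, p. 4.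
  [claim: Groskin2026, status: under-review]
* [CCM] A. Connes, C. Consani, H. Moscovici, *Zeta zeros and prolate wave operators*,
  arXiv:2511.22755v1, eqs. (3.15), (4.4); EMS Ser. Lect. Math. 37 (2026).
* [Bombieri2000Weil] E. Bombieri, Rend. Mat. Acc. Lincei (9) 11 (2000), Thm. 2 and (2.8).
* [CvS] A. Connes, W. D. van Suijlekom, Prop. 4.1 (divided-difference structure).
-/

noncomputable section

open Filter Set MeasureTheory Complex Finset Matrix
open scoped Real Topology FourierTransform

namespace Literature.NumberTheory.LFunctions

namespace Groskin2026

namespace ArchBlock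

open Literature.Analysis.SpecialFunctions
open Literature.NumberTheory.ConnesConsani2025 (qKer archSharp psiSharpArch qKer_of_ne qKer_self
  psiSharpArch_symAutocorr symAutocorr_eq_ofReal_qKer symAutocorr_eq_zero_of_lt continuous_autocorr)
open Literature.Analysis.Fourier.ConnesVanSuijlekom (symAutocorr autocorr symAutocorr_zero
  symAutocorr_right_edge)

variable {c : ℝ}

/-! ## §0 Small trigonometric and continuity helpers -/

/-- `r ↦ ∫ₐᵇ g(y) cos(ry) dy` is continuous for continuous `g`. [folklore] -/
private theorem continuous_integral_mul_cos {g : ℝ → ℝ} (hg : Continuous g) (a b : ℝ) :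
    Continuous fun r : ℝ ↦ ∫ y in a..b, g y * Real.cos (r * y) := by
  have h : Continuous (Function.uncurry fun (r y : ℝ) ↦ g y * Real.cos (r * y)) := by
    exact (by fun_prop : Continuous fun p : ℝ × ℝ ↦ g p.2 * Real.cos (p.1 * p.2))
  exact intervalIntegral.continuous_parametric_intervalIntegral_of_continuous' (μ := volume) h a b

/-- `sin(2πk) = 0` for an integer `k`. [folklore] -/
private theorem sin_two_pi_int (k : ℤ) : Real.sin (2 * π * k) = 0 := by
  have h := Real.sin_add_int_mul_two_pi 0 k
  rw [zero_add, Real.sin_zero] at h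
  rw [show 2 * π * (k : ℝ) = k * (2 * π) by ring]
  exact h

/-- `sin(2πm(1 − y/L)) = −sin(2πmy/L)` for an integer `m`. [folklore] -/
private theorem sin_int_freq (m : ℤ) (L y : ℝ) :
    Real.sin (2 * π * m * (1 - y / L)) = -Real.sin (2 * π * m * y / L) := by
  have h : 2 * π * (m : ℝ) * (1 - y / L) = -(2 * π * m * y / L) + (m : ℝ) * (2 * π) := by ring
  rw [h, Real.sin_add_int_mul_two_pi, Real.sin_neg]

/-- `cos(2πm(1 − y/L)) = cos(2πmy/L)` for an integer `m`. [folklore] -/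
private theorem cos_int_freq (m : ℤ) (L y : ℝ) :
    Real.cos (2 * π * m * (1 - y / L)) = Real.cos (2 * π * m * y / L) := by
  have h : 2 * π * (m : ℝ) * (1 - y / L) = -(2 * π * m * y / L) + (m : ℝ) * (2 * π) := by ring
  rw [h, Real.cos_add_int_mul_two_pi, Real.cos_neg]

/-! ## §1 (E) The entrywise Fourier form of `Q_arch,T` -/

/-- Off the diagonal: `S(r,m,L) − S(r,n,L) = π(m − n) ∫₀ᴸ q(U_m,U_n)(y) cos(ry) dy` at integer nodes
`m ≠ n` — the divided difference of the source `x ↦ sin(2πx(1−y/L))` is `π q(U_m,U_n)(y)`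
([CvS] Prop. 4.1; [CCM] Lemma 2.3 off-diagonal). [cite: Groskin2026, §2.1 (p. 3), «exactly the structure of [11, Prop. 4.1]»] -/
theorem archKernelS_sub_archKernelS (hc : 1 < c) {m n : ℤ} (hmn : m ≠ n) (r : ℝ) :
    archKernelS c r m - archKernelS c r n =
      π * ((m : ℝ) - n) * ∫ y in (0 : ℝ)..Real.log c, qKer (Real.log c) m n y * Real.cos (r * y) := by
  have hL := Real.log_pos hc
  set L := Real.log c with hLdef
  have hmn' : ((m : ℝ) - n) ≠ 0 := sub_ne_zero.2 (by exact_mod_cast hmn)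
  have hπ : (π : ℝ) ≠ 0 := Real.pi_ne_zero
  unfold archKernelS
  have hi : ∀ k : ℤ, IntervalIntegrable (fun y : ℝ ↦ Real.sin (2 * π * k * (1 - y / L)) * Real.cos (r * y))
      volume 0 L := fun k ↦ (by fun_prop : Continuous fun y : ℝ ↦
        Real.sin (2 * π * k * (1 - y / L)) * Real.cos (r * y)).intervalIntegrable _ _
  rw [← intervalIntegral.integral_sub (hi m) (hi n), ← intervalIntegral.integral_const_mul]
  refine intervalIntegral.integral_congr fun y hy ↦ ?_
  rw [uIcc_of_le hL.le] at hy
  rw [qKer_of_ne hL hmn hy, sin_int_freq, sin_int_freq]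
  field_simp
  ring

/-- On the diagonal: `∂ₓS(r,x,L)|_{x=m}` in the form delivered by differentiation under the integral
equals `π ∫₀ᴸ q(U_m,U_m)(y) cos(ry) dy` ([CCM] Lemma 2.3 diagonal: `q(U_m,U_m)(y) = 2(1−y/L)cos(2πmy/L)`).
[cite: Groskin2026, §2.1 (p. 3), «ψ′(m), m = n»] -/
theorem archKernelS_deriv_eq (hc : 1 < c) (m : ℤ) (r : ℝ) :
    ∫ y in (0 : ℝ)..Real.log c, 2 * π * (1 - y / Real.log c) *
        Real.cos (2 * π * m * (1 - y / Real.log c)) * Real.cos (r * y) =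
      π * ∫ y in (0 : ℝ)..Real.log c, qKer (Real.log c) m m y * Real.cos (r * y) := by
  have hL := Real.log_pos hc
  rw [← intervalIntegral.integral_const_mul]
  refine intervalIntegral.integral_congr fun y hy ↦ ?_
  rw [uIcc_of_le hL.le] at hy
  rw [qKer_self hL m hy, cos_int_freq]
  ring

/-- **(E) The entrywise Fourier form of the finite-cutoff archimedean block**: for `c > 1`, every `T`
and `m, n ∈ I_N`,
`(Q_arch,T)_{mn} = (1/2π) ∫_{−T}^{T} h₊(r) (∫₀ᴸ q(U_m,U_n)(y) cos(ry) dy) dr`, `L = log c` — the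
divided-difference matrix of the source `ψ_{R,T}` ([Gr26] (3)) entry by entry, the diagonal being the
derivative of the true source (cc-t18's `hasDerivAt_archSource`).
[cite: Groskin2026, §2.1 eq. (3) (p. 3) and Lemma 2.1 (p. 4)] -/
theorem archMatrix_apply_eq_integral (hc : 1 < c) (N : ℕ) (T : ℝ) (m n : idx N) :
    archMatrix c N T m n = (1 / (2 * π)) * ∫ r in (-T)..T, hPlus r *
      ∫ y in (0 : ℝ)..Real.log c, qKer (Real.log c) m n y * Real.cos (r * y) := by
  have hL := Real.log_pos hc
  unfold archMatrix dividedDiffMatrix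
  simp only [Matrix.of_apply]
  by_cases hmn : (m : ℤ) = (n : ℤ)
  · -- diagonal entry
    have hmn' : m = n := Subtype.ext hmn
    subst hmn'
    simp only [if_true]
    rw [(hasDerivAt_archSource hc T ((m : ℤ) : ℝ)).deriv]
    have hfun : (fun r : ℝ ↦ hPlus r * ∫ y in (0 : ℝ)..Real.log c, 2 * π * (1 - y / Real.log c) *
        Real.cos (2 * π * ((m : ℤ) : ℝ) * (1 - y / Real.log c)) * Real.cos (r * y)) =
        fun r : ℝ ↦ π * (hPlus r *
          ∫ y in (0 : ℝ)..Real.log c, qKer (Real.log c) m m y * Real.cos (r * y)) := by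
      funext r
      rw [archKernelS_deriv_eq hc (m : ℤ) r]
      ring
    rw [hfun, intervalIntegral.integral_const_mul]
    field_simp
  · -- off-diagonal entry
    simp only [hmn, if_false]
    have hmn' : ((m : ℤ) : ℝ) - ((n : ℤ) : ℝ) ≠ 0 := sub_ne_zero.2 (by exact_mod_cast hmn)
    unfold archSource
    have hcm : ∀ k : ℤ, Continuous fun r : ℝ ↦ hPlus r * archKernelS c r k := fun k ↦ by
      unfold archKernelS
      exact continuous_hPlus.mul (continuous_integral_mul_cos (by fun_prop) _ _)
    rw [← mul_sub, ← intervalIntegral.integral_sub ((hcm m).intervalIntegrable _ _)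
      ((hcm n).intervalIntegrable _ _)]
    have hfun : (fun r : ℝ ↦ hPlus r * archKernelS c r ((m : ℤ) : ℝ) - hPlus r * archKernelS c r ((n : ℤ) : ℝ)) =
        fun r : ℝ ↦ (π * (((m : ℤ) : ℝ) - ((n : ℤ) : ℝ))) * (hPlus r *
          ∫ y in (0 : ℝ)..Real.log c, qKer (Real.log c) m n y * Real.cos (r * y)) := by
      funext r
      rw [← mul_sub, archKernelS_sub_archKernelS hc hmn r]
      ring
    rw [hfun, intervalIntegral.integral_const_mul]
    field_simp

/-! ## §2 (D) Decay of the kernel transform `C_{mn}(r) = ∫₀ᴸ q(U_m,U_n)(y) cos(ry) dy` -/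

/-- One integration by parts against `cos(ry)`, `r ≠ 0`. [folklore] -/
private theorem integral_mul_cos_parts {F F' : ℝ → ℝ} (hF : ∀ y, HasDerivAt F (F' y) y)
    (hF'c : Continuous F') (a b : ℝ) {r : ℝ} (hr : r ≠ 0) :
    ∫ y in a..b, F y * Real.cos (r * y) =
      (F b * Real.sin (r * b) - F a * Real.sin (r * a)) / r -
        (1 / r) * ∫ y in a..b, F' y * Real.sin (r * y) := by
  have hv : ∀ y : ℝ, HasDerivAt (fun y : ℝ ↦ Real.sin (r * y) / r) (Real.cos (r * y)) y := by
    intro y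
    have h1 : HasDerivAt (fun y : ℝ ↦ r * y) r y := by
      simpa using (hasDerivAt_id y).const_mul r
    have h3 := h1.sin.div_const r
    have e : Real.cos (r * y) * r / r = Real.cos (r * y) := by field_simp
    rw [e] at h3
    exact h3
  have hFc : Continuous F := continuous_iff_continuousAt.2 fun y ↦ (hF y).continuousAt
  have h := intervalIntegral.integral_mul_deriv_eq_deriv_mul (a := a) (b := b) (u := F) (u' := F')
    (v := fun y : ℝ ↦ Real.sin (r * y) / r) (v' := fun y ↦ Real.cos (r * y))
    (fun y _ ↦ hF y) (fun y _ ↦ hv y) (hF'c.intervalIntegrable _ _)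
    ((by fun_prop : Continuous fun y : ℝ ↦ Real.cos (r * y)).intervalIntegrable _ _)
  rw [h]
  have h2 : ∫ y in a..b, F' y * (Real.sin (r * y) / r) = (1 / r) * ∫ y in a..b, F' y * Real.sin (r * y) := by
    rw [← intervalIntegral.integral_const_mul]
    refine intervalIntegral.integral_congr fun y _ ↦ ?_
    field_simp
  rw [h2]
  field_simp

/-- One integration by parts against `sin(ry)`, `r ≠ 0`. [folklore] -/
private theorem integral_mul_sin_parts {F F' : ℝ → ℝ} (hF : ∀ y, HasDerivAt F (F' y) y)
    (hF'c : Continuous F') (a b : ℝ) {r : ℝ} (hr : r ≠ 0) :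
    ∫ y in a..b, F y * Real.sin (r * y) =
      (F a * Real.cos (r * a) - F b * Real.cos (r * b)) / r +
        (1 / r) * ∫ y in a..b, F' y * Real.cos (r * y) := by
  have hv : ∀ y : ℝ, HasDerivAt (fun y : ℝ ↦ -Real.cos (r * y) / r) (Real.sin (r * y)) y := by
    intro y
    have h1 : HasDerivAt (fun y : ℝ ↦ r * y) r y := by
      simpa using (hasDerivAt_id y).const_mul r
    have h3 := h1.cos.neg.div_const r
    have e : -(-Real.sin (r * y) * r) / r = Real.sin (r * y) := by field_simp
    rw [e] at h3
    exact h3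
  have h := intervalIntegral.integral_mul_deriv_eq_deriv_mul (a := a) (b := b) (u := F) (u' := F')
    (v := fun y : ℝ ↦ -Real.cos (r * y) / r) (v' := fun y ↦ Real.sin (r * y))
    (fun y _ ↦ hF y) (fun y _ ↦ hv y) (hF'c.intervalIntegrable _ _)
    ((by fun_prop : Continuous fun y : ℝ ↦ Real.sin (r * y)).intervalIntegrable _ _)
  rw [h]
  have h2 : ∫ y in a..b, F' y * (-Real.cos (r * y) / r) =
      -((1 / r) * ∫ y in a..b, F' y * Real.cos (r * y)) := by
    rw [← intervalIntegral.integral_const_mul, ← intervalIntegral.integral_neg]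
    refine intervalIntegral.integral_congr fun y _ ↦ ?_
    field_simp
  rw [h2]
  field_simp
  ring

/-- **Two integrations by parts**: for `F ∈ C²` with `F(L) = 0`, the cosine transform
`∫₀ᴸ F(y) cos(ry) dy` is `O(1/(1 + r²))` ([Gr26] Lemma 2.1 proof: «`S(r,n,L) = O(r⁻²)` and
`∂ₓS(r,x,L)|_{x=n} = O(r⁻²)`»). [cite: Groskin2026, Lemma 2.1 (p. 4)] -/
theorem exists_abs_integral_mul_cos_le {F F' F'' : ℝ → ℝ} {L : ℝ} (hL : 0 ≤ L)
    (hF : ∀ y, HasDerivAt F (F' y) y) (hF' : ∀ y, HasDerivAt F' (F'' y) y)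
    (hF''c : Continuous F'') (hFL : F L = 0) :
    ∃ K : ℝ, 0 ≤ K ∧ ∀ r : ℝ, |∫ y in (0 : ℝ)..L, F y * Real.cos (r * y)| ≤ K / (1 + r ^ 2) := by
  have hFc : Continuous F := continuous_iff_continuousAt.2 fun y ↦ (hF y).continuousAt
  have hF'c : Continuous F' := continuous_iff_continuousAt.2 fun y ↦ (hF' y).continuousAt
  obtain ⟨M₀, hM₀⟩ := (isCompact_Icc (a := (0 : ℝ)) (b := L)).exists_bound_of_continuousOn
    hFc.continuousOn
  obtain ⟨M₂, hM₂⟩ := (isCompact_Icc (a := (0 : ℝ)) (b := L)).exists_bound_of_continuousOn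
    hF''c.continuousOn
  have hM₀' : 0 ≤ M₀ := (norm_nonneg _).trans (hM₀ 0 ⟨le_rfl, hL⟩)
  have hM₂' : 0 ≤ M₂ := (norm_nonneg _).trans (hM₂ 0 ⟨le_rfl, hL⟩)
  set A : ℝ := M₀ * L with hA
  set B : ℝ := |F' L| + |F' 0| + M₂ * L with hB
  have hA0 : 0 ≤ A := by positivity
  have hB0 : 0 ≤ B := by positivity
  refine ⟨2 * (A + B), by positivity, fun r ↦ ?_⟩
  -- the trivial bound
  have htriv : |∫ y in (0 : ℝ)..L, F y * Real.cos (r * y)| ≤ A := by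
    have h := intervalIntegral.norm_integral_le_of_norm_le_const (a := (0 : ℝ)) (b := L)
      (C := M₀) (f := fun y ↦ F y * Real.cos (r * y)) fun y hy ↦ by
        rw [uIoc_of_le hL] at hy
        rw [norm_mul]
        calc ‖F y‖ * ‖Real.cos (r * y)‖ ≤ M₀ * 1 :=
              mul_le_mul (hM₀ y ⟨hy.1.le, hy.2⟩) (by rw [Real.norm_eq_abs]; exact Real.abs_cos_le_one _)
                (norm_nonneg _) hM₀'
          _ = M₀ := mul_one _
    rw [sub_zero, abs_of_nonneg hL] at h
    rw [← Real.norm_eq_abs]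
    exact h
  by_cases hr1 : r ^ 2 ≤ 1
  · have hden : 0 < 1 + r ^ 2 := by positivity
    rw [le_div_iff₀ hden]
    nlinarith [abs_nonneg (∫ y in (0 : ℝ)..L, F y * Real.cos (r * y))]
  · rw [not_le] at hr1
    have hr : r ≠ 0 := by
      intro h; rw [h] at hr1; norm_num at hr1
    -- two integrations by parts
    rw [integral_mul_cos_parts hF hF'c 0 L hr, hFL, mul_zero, Real.sin_zero, mul_zero, sub_zero,
      zero_mul, zero_div, zero_sub, integral_mul_sin_parts hF' hF''c 0 L hr, mul_zero, Real.cos_zero,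
      mul_one]
    have hint : |∫ y in (0 : ℝ)..L, F'' y * Real.cos (r * y)| ≤ M₂ * L := by
      have h := intervalIntegral.norm_integral_le_of_norm_le_const (a := (0 : ℝ)) (b := L)
        (C := M₂) (f := fun y ↦ F'' y * Real.cos (r * y)) fun y hy ↦ by
          rw [uIoc_of_le hL] at hy
          rw [norm_mul]
          calc ‖F'' y‖ * ‖Real.cos (r * y)‖ ≤ M₂ * 1 :=
                mul_le_mul (hM₂ y ⟨hy.1.le, hy.2⟩) (by rw [Real.norm_eq_abs]; exact Real.abs_cos_le_one _)
                  (norm_nonneg _) hM₂'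
            _ = M₂ := mul_one _
      rw [sub_zero, abs_of_nonneg hL] at h
      rw [← Real.norm_eq_abs]
      exact h
    have hbd : |(F' 0 - F' L * Real.cos (r * L)) / r +
        1 / r * ∫ y in (0 : ℝ)..L, F'' y * Real.cos (r * y)| ≤ B / |r| := by
      rw [hB]
      have h1 : |(F' 0 - F' L * Real.cos (r * L)) / r| ≤ (|F' L| + |F' 0|) / |r| := by
        rw [abs_div]
        gcongr
        calc |F' 0 - F' L * Real.cos (r * L)| ≤ |F' 0| + |F' L * Real.cos (r * L)| := abs_sub _ _
          _ ≤ |F' 0| + |F' L| := by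
              rw [abs_mul]
              nlinarith [Real.abs_cos_le_one (r * L), abs_nonneg (F' L), abs_nonneg (Real.cos (r * L))]
          _ = |F' L| + |F' 0| := add_comm _ _
      have h2 : |1 / r * ∫ y in (0 : ℝ)..L, F'' y * Real.cos (r * y)| ≤ M₂ * L / |r| := by
        rw [abs_mul, abs_div, abs_one, one_div_mul_eq_div]
        gcongr
      calc _ ≤ |(F' 0 - F' L * Real.cos (r * L)) / r| +
            |1 / r * ∫ y in (0 : ℝ)..L, F'' y * Real.cos (r * y)| := abs_add_le _ _
        _ ≤ (|F' L| + |F' 0|) / |r| + M₂ * L / |r| := add_le_add h1 h2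
        _ = (|F' L| + |F' 0| + M₂ * L) / |r| := by ring
    have hrpos : 0 < |r| := abs_pos.2 hr
    rw [abs_neg, abs_mul, abs_div, abs_one]
    have hr2 : r ^ 2 = |r| ^ 2 := (sq_abs r).symm
    calc 1 / |r| * |(F' 0 - F' L * Real.cos (r * L)) / r +
          1 / r * ∫ y in (0 : ℝ)..L, F'' y * Real.cos (r * y)|
        ≤ 1 / |r| * (B / |r|) := by gcongr
      _ = B / r ^ 2 := by rw [hr2]; field_simp
      _ ≤ 2 * (A + B) / (1 + r ^ 2) := by
          rw [div_le_div_iff₀ (by positivity) (by positivity)]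
          nlinarith

/-- **(D) Decay of the kernel transform**: for `L > 0` and integers `m, n` there is `K ≥ 0` with
`|∫₀ᴸ q(U_m,U_n)(y) cos(ry) dy| ≤ K/(1 + r²)` for all real `r` (the kernel is smooth on `[0, L]` and
vanishes at `y = L`: [CCM] Lemma 2.3 closed forms; [Gr26] Lemma 2.1 proof «`S(r,n,L) = O(r⁻²)`»).
[cite: Groskin2026, Lemma 2.1 (p. 4)] -/
theorem exists_abs_kernelCos_le {L : ℝ} (hL : 0 < L) (m n : ℤ) :
    ∃ K : ℝ, 0 ≤ K ∧ ∀ r : ℝ,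
      |∫ y in (0 : ℝ)..L, qKer L m n y * Real.cos (r * y)| ≤ K / (1 + r ^ 2) := by
  -- derivatives of `y ↦ sin(ky)`, `y ↦ cos(ky)`
  have hsin : ∀ k y : ℝ, HasDerivAt (fun y : ℝ ↦ Real.sin (k * y)) (k * Real.cos (k * y)) y := by
    intro k y
    have h1 : HasDerivAt (fun y : ℝ ↦ k * y) k y := by simpa using (hasDerivAt_id y).const_mul k
    have h2 := h1.sin
    have e : Real.cos (k * y) * k = k * Real.cos (k * y) := mul_comm _ _
    rw [e] at h2
    exact h2
  have hcos : ∀ k y : ℝ, HasDerivAt (fun y : ℝ ↦ Real.cos (k * y)) (-(k * Real.sin (k * y))) y := by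
    intro k y
    have h1 : HasDerivAt (fun y : ℝ ↦ k * y) k y := by simpa using (hasDerivAt_id y).const_mul k
    have h2 := h1.cos
    have e : -Real.sin (k * y) * k = -(k * Real.sin (k * y)) := by ring
    rw [e] at h2
    exact h2
  by_cases hmn : m = n
  · subst hmn
    -- diagonal kernel `2(1 − y/L) cos(ay)`, `a = 2πm/L`
    have hu : ∀ y : ℝ, HasDerivAt (fun y : ℝ ↦ 2 * (1 - y / L)) (-(2 / L)) y := by
      intro y
      have h := ((hasDerivAt_id y).div_const L).const_sub 1 |>.const_mul 2
      have e : (2 : ℝ) * -(1 / L) = -(2 / L) := by ring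
      rw [e] at h
      exact h
    have hF : ∀ y : ℝ, HasDerivAt (fun y : ℝ ↦ 2 * (1 - y / L) * Real.cos (2 * π * m / L * y))
        (-(2 / L) * Real.cos (2 * π * m / L * y) +
          2 * (1 - y / L) * (-(2 * π * m / L * Real.sin (2 * π * m / L * y)))) y :=
      fun y ↦ (hu y).mul (hcos _ y)
    have hw : ∀ y : ℝ, HasDerivAt (fun y : ℝ ↦ -(2 * π * m / L * Real.sin (2 * π * m / L * y)))
        (-(2 * π * m / L * (2 * π * m / L * Real.cos (2 * π * m / L * y)))) y :=
      fun y ↦ ((hsin _ y).const_mul _).neg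
    have hF' : ∀ y : ℝ, HasDerivAt
        (fun y : ℝ ↦ -(2 / L) * Real.cos (2 * π * m / L * y) +
          2 * (1 - y / L) * (-(2 * π * m / L * Real.sin (2 * π * m / L * y))))
        (-(2 / L) * (-(2 * π * m / L * Real.sin (2 * π * m / L * y))) +
          (-(2 / L) * (-(2 * π * m / L * Real.sin (2 * π * m / L * y))) +
            2 * (1 - y / L) * (-(2 * π * m / L * (2 * π * m / L * Real.cos (2 * π * m / L * y)))))) y :=
      fun y ↦ ((hcos _ y).const_mul _).add ((hu y).mul (hw y))
    have hF''c : Continuous fun y : ℝ ↦ -(2 / L) * (-(2 * π * m / L * Real.sin (2 * π * m / L * y))) +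
        (-(2 / L) * (-(2 * π * m / L * Real.sin (2 * π * m / L * y))) +
          2 * (1 - y / L) * (-(2 * π * m / L * (2 * π * m / L * Real.cos (2 * π * m / L * y))))) := by
      fun_prop
    have hFL : (fun y : ℝ ↦ 2 * (1 - y / L) * Real.cos (2 * π * m / L * y)) L = 0 := by
      simp [div_self hL.ne']
    obtain ⟨K, hK0, hK⟩ := exists_abs_integral_mul_cos_le hL.le hF hF' hF''c hFL
    refine ⟨K, hK0, fun r ↦ ?_⟩
    have heq : ∫ y in (0 : ℝ)..L, qKer L m m y * Real.cos (r * y) =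
        ∫ y in (0 : ℝ)..L, (fun y : ℝ ↦ 2 * (1 - y / L) * Real.cos (2 * π * m / L * y)) y *
          Real.cos (r * y) := by
      refine intervalIntegral.integral_congr fun y hy ↦ ?_
      rw [uIcc_of_le hL.le] at hy
      have e : 2 * π * (m : ℝ) * y / L = 2 * π * m / L * y := by ring
      simp only [qKer_self hL m hy, e]
    rw [heq]
    exact hK r
  · -- off-diagonal kernel `(sin(by) − sin(ay))/(π(m − n))`, `a = 2πm/L`, `b = 2πn/L`
    have hd0 : (π * ((m : ℝ) - n)) ≠ 0 :=
      mul_ne_zero Real.pi_ne_zero (sub_ne_zero.2 (by exact_mod_cast hmn))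
    have hF : ∀ y : ℝ, HasDerivAt
        (fun y : ℝ ↦ (Real.sin (2 * π * n / L * y) - Real.sin (2 * π * m / L * y)) / (π * ((m : ℝ) - n)))
        ((2 * π * n / L * Real.cos (2 * π * n / L * y) - 2 * π * m / L * Real.cos (2 * π * m / L * y)) /
          (π * ((m : ℝ) - n))) y :=
      fun y ↦ ((hsin _ y).sub (hsin _ y)).div_const _
    have hF' : ∀ y : ℝ, HasDerivAt
        (fun y : ℝ ↦ (2 * π * n / L * Real.cos (2 * π * n / L * y) -
          2 * π * m / L * Real.cos (2 * π * m / L * y)) / (π * ((m : ℝ) - n)))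
        ((2 * π * n / L * (-(2 * π * n / L * Real.sin (2 * π * n / L * y))) -
          2 * π * m / L * (-(2 * π * m / L * Real.sin (2 * π * m / L * y)))) / (π * ((m : ℝ) - n))) y :=
      fun y ↦ (((hcos _ y).const_mul _).sub ((hcos _ y).const_mul _)).div_const _
    have hF''c : Continuous fun y : ℝ ↦ (2 * π * n / L * (-(2 * π * n / L * Real.sin (2 * π * n / L * y))) -
        2 * π * m / L * (-(2 * π * m / L * Real.sin (2 * π * m / L * y)))) / (π * ((m : ℝ) - n)) := by
      fun_prop
    have hFL : (fun y : ℝ ↦ (Real.sin (2 * π * n / L * y) - Real.sin (2 * π * m / L * y)) /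
        (π * ((m : ℝ) - n))) L = 0 := by
      have e1 : 2 * π * (n : ℝ) / L * L = 2 * π * n := by field_simp
      have e2 : 2 * π * (m : ℝ) / L * L = 2 * π * m := by field_simp
      simp only [e1, e2, sin_two_pi_int, sub_self, zero_div]
    obtain ⟨K, hK0, hK⟩ := exists_abs_integral_mul_cos_le hL.le hF hF' hF''c hFL
    refine ⟨K, hK0, fun r ↦ ?_⟩
    have heq : ∫ y in (0 : ℝ)..L, qKer L m n y * Real.cos (r * y) =
        ∫ y in (0 : ℝ)..L, (fun y : ℝ ↦ (Real.sin (2 * π * n / L * y) - Real.sin (2 * π * m / L * y)) /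
          (π * ((m : ℝ) - n))) y * Real.cos (r * y) := by
      refine intervalIntegral.integral_congr fun y hy ↦ ?_
      rw [uIcc_of_le hL.le] at hy
      have e1 : 2 * π * (n : ℝ) * y / L = 2 * π * n / L * y := by ring
      have e2 : 2 * π * (m : ℝ) * y / L = 2 * π * m / L * y := by ring
      simp only [qKer_of_ne hL hmn hy, e1, e2]
    rw [heq]
    exact hK r

/-! ## §3 (L) Integrability against a logarithmic weight and the `T → ∞` limit -/

/-- The kernel `q(U_m,U_n)` is continuous. [cite: Groskin2026, §2.1 (p. 3)] -/
private theorem continuous_qKer {L : ℝ} (hL : 0 < L) (m n : ℤ) : Continuous (qKer L m n) := by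
  have h : Continuous fun y : ℝ ↦ symAutocorr L m n y := by
    unfold symAutocorr
    exact (continuous_autocorr hL m n).add ((continuous_autocorr hL m n).comp continuous_neg)
  unfold qKer
  exact Complex.continuous_re.comp h

/-- A continuous `φ` with `|φ(r)| ≤ A + log(1+|r|)` against a continuous `C` with `|C(r)| ≤ K/(1+r²)`
is integrable on `ℝ` ([Gr26] Lemma 2.1 proof: «while `h₊(r) = O(log r)`»). [cite: Groskin2026, Lemma 2.1 (p. 4)] -/
private theorem integrable_mul_of_log_of_decay {φ C : ℝ → ℝ} (hφ : Continuous φ)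
    (hC : Continuous C) {A K : ℝ} (hA : 0 ≤ A) (hK : 0 ≤ K)
    (hφb : ∀ r, |φ r| ≤ A + Real.log (1 + |r|)) (hCb : ∀ r, |C r| ≤ K / (1 + r ^ 2)) :
    Integrable fun r : ℝ ↦ φ r * C r := by
  have hint : Integrable fun t : ℝ ↦ 2 * K * (A + 2) * (1 + ‖t‖) ^ (-(3 / 2 : ℝ)) :=
    (integrable_one_add_norm (E := ℝ) (μ := volume)
      (by rw [Module.finrank_self]; norm_num)).const_mul (2 * K * (A + 2))
  refine hint.mono' ((hφ.mul hC).aestronglyMeasurable) (Eventually.of_forall fun t ↦ ?_)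
  set u : ℝ := 1 + |t| with hu
  have hu1 : 1 ≤ u := by rw [hu]; linarith [abs_nonneg t]
  have hu0 : 0 < u := by linarith
  have hlog0 : 0 ≤ Real.log u := Real.log_nonneg hu1
  have hlog : Real.log u ≤ 2 * u ^ (1 / 2 : ℝ) := by
    have := Real.log_le_rpow_div hu0.le (by norm_num : (0 : ℝ) < 1 / 2)
    linarith
  have hsqrt1 : 1 ≤ u ^ (1 / 2 : ℝ) := Real.one_le_rpow hu1 (by norm_num)
  have hnum : A + Real.log u ≤ (A + 2) * u ^ (1 / 2 : ℝ) := by nlinarith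
  have hpow : u ^ (1 / 2 : ℝ) / u ^ 2 = u ^ (-(3 / 2 : ℝ)) := by
    rw [show (-(3 / 2 : ℝ)) = 1 / 2 - 2 by norm_num, Real.rpow_sub hu0, Real.rpow_two]
  have hsq : u ^ 2 ≤ 2 * (1 + t ^ 2) := by
    rw [hu]; nlinarith [abs_nonneg t, sq_abs t, sq_nonneg (|t| - 1)]
  have hCu : |C t| ≤ 2 * K / u ^ 2 := by
    calc |C t| ≤ K / (1 + t ^ 2) := hCb t
      _ ≤ 2 * K / u ^ 2 := by
          rw [div_le_div_iff₀ (by positivity) (by positivity)]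
          nlinarith
  rw [Real.norm_eq_abs, Real.norm_eq_abs, abs_mul, ← hu]
  calc |φ t| * |C t| ≤ (A + Real.log u) * (2 * K / u ^ 2) :=
        mul_le_mul (hφb t) hCu (abs_nonneg _) (add_nonneg hA hlog0)
    _ ≤ ((A + 2) * u ^ (1 / 2 : ℝ)) * (2 * K / u ^ 2) := by gcongr
    _ = 2 * K * (A + 2) * (u ^ (1 / 2 : ℝ) / u ^ 2) := by ring
    _ = 2 * K * (A + 2) * u ^ (-(3 / 2 : ℝ)) := by rw [hpow]

/-- `|h₊(r)| ≤ A + log(1 + |r|)` ([Gr26] «`h₊(r) = O(log r)`», from cc-t6's h₊ toolkit via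
`ZeroSide.abs_reDigammaQuarter_le_log`). [cite: Groskin2026, Lemma 2.1 (p. 4)] -/
theorem abs_hPlus_le_log (r : ℝ) :
    |hPlus r| ≤ (|reDigammaQuarter 0| + Real.log 7 + Real.log π + Real.log π) +
      Real.log (1 + |r|) := by
  have h := ZeroSide.abs_reDigammaQuarter_le_log r
  have hπ : 0 ≤ Real.log π := Real.log_nonneg (by linarith [Real.pi_gt_three])
  unfold hPlus
  calc |reDigammaQuarter r - Real.log π| ≤ |reDigammaQuarter r| + |Real.log π| := abs_sub _ _
    _ ≤ _ := by rw [abs_of_nonneg hπ]; linarith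

/-- `C_{mn} ∈ L¹(ℝ)`. [cite: Groskin2026, Lemma 2.1 (p. 4)] -/
theorem integrable_kernelCos {L : ℝ} (hL : 0 < L) (m n : ℤ) :
    Integrable fun r : ℝ ↦ ∫ y in (0 : ℝ)..L, qKer L m n y * Real.cos (r * y) := by
  obtain ⟨K, hK0, hK⟩ := exists_abs_kernelCos_le hL m n
  have h := integrable_mul_of_log_of_decay (φ := fun _ : ℝ ↦ (1 : ℝ)) continuous_const
    (continuous_integral_mul_cos (continuous_qKer hL m n) 0 L) zero_le_one hK0
    (fun r ↦ by rw [abs_one]; linarith [Real.log_nonneg (by linarith [abs_nonneg r] : (1 : ℝ) ≤ 1 + |r|)])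
    hK
  simpa only [one_mul] using h

/-- `h₊ C_{mn} ∈ L¹(ℝ)` («`S = O(r⁻²)` … while `h₊(r) = O(log r)`»). [cite: Groskin2026, Lemma 2.1 (p. 4)] -/
theorem integrable_hPlus_mul_kernelCos {L : ℝ} (hL : 0 < L) (m n : ℤ) :
    Integrable fun r : ℝ ↦ hPlus r * ∫ y in (0 : ℝ)..L, qKer L m n y * Real.cos (r * y) := by
  obtain ⟨K, hK0, hK⟩ := exists_abs_kernelCos_le hL m n
  have hA0 : 0 ≤ |reDigammaQuarter 0| + Real.log 7 + Real.log π + Real.log π := by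
    have h7 : 0 ≤ Real.log 7 := Real.log_nonneg (by norm_num)
    have hπ : 0 ≤ Real.log π := Real.log_nonneg (by linarith [Real.pi_gt_three])
    positivity
  exact integrable_mul_of_log_of_decay continuous_hPlus
    (continuous_integral_mul_cos (continuous_qKer hL m n) 0 L) hA0 hK0 abs_hPlus_le_log hK

/-- `Re ψ(¼ + ir/2) C_{mn}(r) ∈ L¹(ℝ)`. [cite: Groskin2026, Lemma 2.1 (p. 4)] -/
theorem integrable_reDigammaQuarter_mul_kernelCos {L : ℝ} (hL : 0 < L) (m n : ℤ) :
    Integrable fun r : ℝ ↦ reDigammaQuarter r *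
      ∫ y in (0 : ℝ)..L, qKer L m n y * Real.cos (r * y) := by
  obtain ⟨K, hK0, hK⟩ := exists_abs_kernelCos_le hL m n
  have hA0 : 0 ≤ |reDigammaQuarter 0| + Real.log 7 + Real.log π := by
    have h7 : 0 ≤ Real.log 7 := Real.log_nonneg (by norm_num)
    have hπ : 0 ≤ Real.log π := Real.log_nonneg (by linarith [Real.pi_gt_three])
    positivity
  exact integrable_mul_of_log_of_decay continuous_reDigammaQuarter
    (continuous_integral_mul_cos (continuous_qKer hL m n) 0 L) hA0 hK0
    ZeroSide.abs_reDigammaQuarter_le_log hK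

/-- **(L) The entrywise limit exists**: `(Q_arch,T)_{mn} → (1/2π)∫_ℝ h₊(r) C_{mn}(r) dr` as
`T → ∞`. [cite: Groskin2026, Lemma 2.1 (p. 4), «the entrywise T-limit exists»] -/
theorem tendsto_archMatrix (hc : 1 < c) (N : ℕ) (m n : idx N) :
    Tendsto (fun T : ℝ ↦ archMatrix c N T m n) atTop
      (𝓝 ((1 / (2 * π)) * ∫ r : ℝ, hPlus r *
        ∫ y in (0 : ℝ)..Real.log c, qKer (Real.log c) m n y * Real.cos (r * y))) := by
  have hL := Real.log_pos hc
  have h := (intervalIntegral_tendsto_integral (integrable_hPlus_mul_kernelCos hL m n)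
    tendsto_neg_atTop_atBot tendsto_id).const_mul (1 / (2 * π))
  refine Tendsto.congr' (Eventually.of_forall fun T ↦ ?_) h
  exact (archMatrix_apply_eq_integral hc N T m n).symm

/-! ## §4 (V) The value `(1/2π)∫_ℝ h₊ C_{mn} = −W♯_ℝ(q(U_m,U_n))` via the even kernel `G = symAutocorr L m n` -/

/-- `G` is even. [folklore] -/
private theorem symAutocorr_neg (L : ℝ) (m n : ℤ) (t : ℝ) :
    symAutocorr L m n (-t) = symAutocorr L m n t := by
  unfold symAutocorr; rw [neg_neg, add_comm]

/-- `G(t) = 0` for `|t| ≥ L`. [folklore] -/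
private theorem symAutocorr_eq_zero_of_le_abs {L : ℝ} (hL : 0 < L) (m n : ℤ) {t : ℝ}
    (ht : L ≤ |t|) : symAutocorr L m n t = 0 := by
  rcases ht.lt_or_eq with h | h
  · rcases le_or_gt 0 t with ht0 | ht0
    · rw [abs_of_nonneg ht0] at h; exact symAutocorr_eq_zero_of_lt m n h
    · rw [abs_of_neg ht0] at h
      rw [← symAutocorr_neg]; exact symAutocorr_eq_zero_of_lt m n h
  · rcases le_or_gt 0 t with ht0 | ht0
    · rw [abs_of_nonneg ht0] at h; rw [← h]; exact symAutocorr_right_edge hL m n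
    · rw [abs_of_neg ht0] at h; rw [← symAutocorr_neg, ← h]; exact symAutocorr_right_edge hL m n

/-- `G` is continuous. [folklore] -/
private theorem continuous_symAutocorr {L : ℝ} (hL : 0 < L) (m n : ℤ) :
    Continuous (symAutocorr L m n) := by
  have h : Continuous fun y : ℝ ↦ symAutocorr L m n y := by
    unfold symAutocorr
    exact (continuous_autocorr hL m n).add ((continuous_autocorr hL m n).comp continuous_neg)
  exact h

/-- `G` is compactly supported (in `[−L, L]`). [folklore] -/
private theorem hasCompactSupport_symAutocorr {L : ℝ} (hL : 0 < L) (m n : ℤ) :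
    HasCompactSupport (symAutocorr L m n) := by
  refine HasCompactSupport.intro (isCompact_Icc (a := -L) (b := L)) fun t ht ↦ ?_
  apply symAutocorr_eq_zero_of_le_abs hL m n
  rw [Set.mem_Icc, not_and_or, not_le, not_le] at ht
  rcases ht with h | h
  · rw [abs_of_neg (by linarith)]; linarith
  · rw [abs_of_pos (by linarith)]; linarith

/-- Clamp representation `G(t) = q(U_m,U_n)(min(|t|, L))`. [folklore] -/
private theorem symAutocorr_eq_qKer_clamp {L : ℝ} (hL : 0 < L) (m n : ℤ) (t : ℝ) :
    symAutocorr L m n t = ((qKer L m n (min ‖t‖ L) : ℝ) : ℂ) := by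
  rw [Real.norm_eq_abs]
  rcases le_or_gt (|t|) L with h | h
  · rw [min_eq_left h]
    rcases le_or_gt 0 t with ht0 | ht0
    · rw [abs_of_nonneg ht0]
      exact symAutocorr_eq_ofReal_qKer hL m n ⟨ht0, by rwa [abs_of_nonneg ht0] at h⟩
    · rw [abs_of_neg ht0, ← symAutocorr_neg]
      exact symAutocorr_eq_ofReal_qKer hL m n ⟨by linarith, by rwa [abs_of_neg ht0] at h⟩
  · rw [min_eq_right h.le, symAutocorr_eq_zero_of_le_abs hL m n h.le]
    unfold qKer
    rw [symAutocorr_right_edge hL m n]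
    simp

/-- Closed form on `[0, L]`, diagonal. [cite: Groskin2026, §2.1 (p. 3), «ψ′(m), m = n»] -/
private theorem qKer_diag_eq {L : ℝ} (hL : 0 < L) (m : ℤ) {y : ℝ} (hy : y ∈ Icc 0 L) :
    qKer L m m y = 2 * (1 - y / L) * Real.cos (2 * π * m / L * y) := by
  have e : 2 * π * (m : ℝ) * y / L = 2 * π * m / L * y := by ring
  rw [qKer_self hL m hy, e]

/-- Closed form on `[0, L]`, off-diagonal. [cite: Groskin2026, §2.1 (p. 3)] -/
private theorem qKer_offDiag_eq {L : ℝ} (hL : 0 < L) {m n : ℤ} (hmn : m ≠ n) {y : ℝ}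
    (hy : y ∈ Icc 0 L) :
    qKer L m n y = (Real.sin (2 * π * n / L * y) - Real.sin (2 * π * m / L * y)) /
      (π * ((m : ℝ) - n)) := by
  have e1 : 2 * π * (n : ℝ) * y / L = 2 * π * n / L * y := by ring
  have e2 : 2 * π * (m : ℝ) * y / L = 2 * π * m / L * y := by ring
  rw [qKer_of_ne hL hmn hy, e1, e2]

/-- `d/dy sin(ky) = k cos(ky)`. [folklore] -/
private theorem hasDerivAt_sin_mul (k y : ℝ) :
    HasDerivAt (fun y : ℝ ↦ Real.sin (k * y)) (k * Real.cos (k * y)) y := by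
  have h1 : HasDerivAt (fun y : ℝ ↦ k * y) k y := by simpa using (hasDerivAt_id y).const_mul k
  have h2 := h1.sin
  have e : Real.cos (k * y) * k = k * Real.cos (k * y) := mul_comm _ _
  rw [e] at h2
  exact h2

/-- `d/dy cos(ky) = −k sin(ky)`. [folklore] -/
private theorem hasDerivAt_cos_mul (k y : ℝ) :
    HasDerivAt (fun y : ℝ ↦ Real.cos (k * y)) (-(k * Real.sin (k * y))) y := by
  have h1 : HasDerivAt (fun y : ℝ ↦ k * y) k y := by simpa using (hasDerivAt_id y).const_mul k
  have h2 := h1.cos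
  have e : -Real.sin (k * y) * k = -(k * Real.sin (k * y)) := by ring
  rw [e] at h2
  exact h2

/-- Derivative of the diagonal closed form `2(1 − y/L)cos(2πmy/L)`. [folklore] -/
private theorem hasDerivAt_diagKernel (L : ℝ) (m : ℤ) (y : ℝ) :
    HasDerivAt (fun y : ℝ ↦ 2 * (1 - y / L) * Real.cos (2 * π * m / L * y))
      (-(2 / L) * Real.cos (2 * π * m / L * y) +
        2 * (1 - y / L) * (-(2 * π * m / L * Real.sin (2 * π * m / L * y)))) y := by
  have hu : HasDerivAt (fun y : ℝ ↦ 2 * (1 - y / L)) (-(2 / L)) y := by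
    have h := ((hasDerivAt_id y).div_const L).const_sub 1 |>.const_mul 2
    have e : (2 : ℝ) * -(1 / L) = -(2 / L) := by ring
    rw [e] at h
    exact h
  exact hu.mul (hasDerivAt_cos_mul _ y)

/-- Derivative of the off-diagonal closed form `(sin(2πny/L) − sin(2πmy/L))/(π(m − n))`. [folklore] -/
private theorem hasDerivAt_offDiagKernel (L : ℝ) (m n : ℤ) (y : ℝ) :
    HasDerivAt (fun y : ℝ ↦ (Real.sin (2 * π * n / L * y) - Real.sin (2 * π * m / L * y)) /
        (π * ((m : ℝ) - n)))
      ((2 * π * n / L * Real.cos (2 * π * n / L * y) - 2 * π * m / L * Real.cos (2 * π * m / L * y)) /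
        (π * ((m : ℝ) - n))) y :=
  ((hasDerivAt_sin_mul _ y).sub (hasDerivAt_sin_mul _ y)).div_const _

/-- `q(U_m,U_n)` is Lipschitz on `[0, L]` (it is smooth there). [folklore] -/
private theorem exists_lipschitzOnWith_qKer {L : ℝ} (hL : 0 < L) (m n : ℤ) :
    ∃ K : NNReal, LipschitzOnWith K (qKer L m n) (Icc 0 L) := by
  by_cases hmn : m = n
  · subst hmn
    obtain ⟨M, hM⟩ := (isCompact_Icc (a := (0 : ℝ)) (b := L)).exists_bound_of_continuousOn
      ((by fun_prop : Continuous fun y : ℝ ↦ -(2 / L) * Real.cos (2 * π * m / L * y) +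
        2 * (1 - y / L) * (-(2 * π * m / L * Real.sin (2 * π * m / L * y))))).continuousOn
    refine ⟨⟨max M 0, le_max_right _ _⟩, ?_⟩
    refine (convex_Icc 0 L).lipschitzOnWith_of_nnnorm_hasDerivWithin_le
      (f' := fun y ↦ -(2 / L) * Real.cos (2 * π * m / L * y) +
        2 * (1 - y / L) * (-(2 * π * m / L * Real.sin (2 * π * m / L * y))))
      (fun y hy ↦ ?_) (fun y hy ↦ ?_)
    · exact (hasDerivAt_diagKernel L m y).hasDerivWithinAt.congr
        (fun x hx ↦ qKer_diag_eq hL m hx) (qKer_diag_eq hL m hy)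
    · rw [← NNReal.coe_le_coe, coe_nnnorm]
      exact (hM y hy).trans (le_max_left _ _)
  · obtain ⟨M, hM⟩ := (isCompact_Icc (a := (0 : ℝ)) (b := L)).exists_bound_of_continuousOn
      ((by fun_prop : Continuous fun y : ℝ ↦ (2 * π * n / L * Real.cos (2 * π * n / L * y) -
        2 * π * m / L * Real.cos (2 * π * m / L * y)) / (π * ((m : ℝ) - n)))).continuousOn
    refine ⟨⟨max M 0, le_max_right _ _⟩, ?_⟩
    refine (convex_Icc 0 L).lipschitzOnWith_of_nnnorm_hasDerivWithin_le
      (f' := fun y ↦ (2 * π * n / L * Real.cos (2 * π * n / L * y) -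
        2 * π * m / L * Real.cos (2 * π * m / L * y)) / (π * ((m : ℝ) - n)))
      (fun y hy ↦ ?_) (fun y hy ↦ ?_)
    · exact (hasDerivAt_offDiagKernel L m n y).hasDerivWithinAt.congr
        (fun x hx ↦ qKer_offDiag_eq hL hmn hx) (qKer_offDiag_eq hL hmn hy)
    · rw [← NNReal.coe_le_coe, coe_nnnorm]
      exact (hM y hy).trans (le_max_left _ _)

/-- `G` is Lipschitz (continuous, piecewise smooth, constant off `[−L, L]`). [folklore] -/
private theorem exists_lipschitzWith_symAutocorr {L : ℝ} (hL : 0 < L) (m n : ℤ) :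
    ∃ K : NNReal, LipschitzWith K (symAutocorr L m n) := by
  obtain ⟨K, hK⟩ := exists_lipschitzOnWith_qKer hL m n
  have hnorm : LipschitzWith 1 (norm : ℝ → ℝ) := lipschitzWith_one_norm
  have hclamp : LipschitzWith 1 (fun t : ℝ ↦ min ‖t‖ L) := hnorm.min_const L
  have hmaps : MapsTo (fun t : ℝ ↦ min ‖t‖ L) univ (Icc 0 L) := fun t _ ↦
    ⟨le_min (norm_nonneg t) hL.le, min_le_right _ _⟩
  have h1 : LipschitzOnWith (K * 1) (qKer L m n ∘ fun t : ℝ ↦ min ‖t‖ L) univ :=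
    hK.comp hclamp.lipschitzOnWith hmaps
  have h2 : LipschitzWith (K * 1) (qKer L m n ∘ fun t : ℝ ↦ min ‖t‖ L) :=
    lipschitzOnWith_univ.1 h1
  have h3 : LipschitzWith (1 * (K * 1))
      (((↑) : ℝ → ℂ) ∘ (qKer L m n ∘ fun t : ℝ ↦ min ‖t‖ L)) :=
    Complex.isometry_ofReal.lipschitz.comp h2
  refine ⟨1 * (K * 1), ?_⟩
  have hfun : symAutocorr L m n = ((↑) : ℝ → ℂ) ∘ (qKer L m n ∘ fun t : ℝ ↦ min ‖t‖ L) := by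
    funext t; exact symAutocorr_eq_qKer_clamp hL m n t
  rw [hfun]
  exact h3

/-- **`Ĝ(½ + ir) = 2 C_{mn}(r)`**: the Mellin–Weil transform of the even kernel `G` on the critical
line is twice the cosine transform of `q(U_m,U_n)` on `[0, L]`. [cite: Groskin2026, Lemma 2.1 (p. 4), «h₊ is the density of W_ℝ»] -/
theorem weilMellin_symAutocorr {L : ℝ} (hL : 0 < L) (m n : ℤ) (r : ℝ) :
    weilMellin (symAutocorr L m n) (1 / 2 + r * I) =
      2 * (((∫ y in (0 : ℝ)..L, qKer L m n y * Real.cos (r * y)) : ℝ) : ℂ) := by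
  unfold weilMellin
  have hs : (1 / 2 + (r : ℂ) * I - 1 / 2) = r * I := by ring
  simp_rw [hs]
  have hfc : Continuous fun t : ℝ ↦ symAutocorr L m n t * cexp (↑r * I * ↑t) :=
    (continuous_symAutocorr hL m n).mul (by fun_prop)
  have hsupp : (∫ t : ℝ, symAutocorr L m n t * cexp (↑r * I * ↑t)) =
      ∫ t in (-L)..L, symAutocorr L m n t * cexp (↑r * I * ↑t) := by
    refine (intervalIntegral.integral_eq_integral_of_support_subset fun t ht ↦ ?_).symm
    rw [Function.mem_support] at ht
    by_contra hmem
    apply ht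
    rw [Set.mem_Ioc, not_and_or, not_lt, not_le] at hmem
    have h0 : symAutocorr L m n t = 0 := by
      apply symAutocorr_eq_zero_of_le_abs hL m n
      rcases hmem with h | h
      · rw [abs_of_nonpos (by linarith)]; linarith
      · rw [abs_of_pos (by linarith)]; linarith
    rw [h0, zero_mul]
  rw [hsupp, ← intervalIntegral.integral_add_adjacent_intervals (b := 0)
    (hfc.intervalIntegrable _ _) (hfc.intervalIntegrable _ _)]
  have hneg : (∫ t in (-L)..0, symAutocorr L m n t * cexp (↑r * I * ↑t)) =
      ∫ t in (0 : ℝ)..L, symAutocorr L m n (-t) * cexp (↑r * I * ↑(-t)) := by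
    rw [intervalIntegral.integral_comp_neg (fun t : ℝ ↦ symAutocorr L m n t * cexp (↑r * I * ↑t)),
      neg_zero]
  have hi1 : IntervalIntegrable (fun t : ℝ ↦ symAutocorr L m n (-t) * cexp (↑r * I * ↑(-t)))
      volume 0 L := (hfc.comp continuous_neg).intervalIntegrable 0 L
  rw [hneg, ← intervalIntegral.integral_add hi1 (hfc.intervalIntegrable _ _)]
  have hsum : EqOn (fun t : ℝ ↦ symAutocorr L m n (-t) * cexp (↑r * I * ↑(-t)) +
      symAutocorr L m n t * cexp (↑r * I * ↑t))
      (fun t : ℝ ↦ (((2 * (qKer L m n t * Real.cos (r * t)) : ℝ) : ℂ))) (uIcc (0 : ℝ) L) := by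
    intro t ht
    rw [uIcc_of_le hL.le] at ht
    simp only []
    rw [symAutocorr_neg, symAutocorr_eq_ofReal_qKer hL m n ht]
    have e1 : cexp (↑r * I * ↑(-t)) = cexp (-(↑r * ↑t) * I) := by congr 1; push_cast; ring
    have e2 : cexp (↑r * I * ↑t) = cexp ((↑r * ↑t) * I) := by congr 1; ring
    rw [e1, e2]
    push_cast
    have e3 : (2 : ℂ) * (((qKer L m n t : ℝ) : ℂ) * Complex.cos (↑r * ↑t)) =
        ((qKer L m n t : ℝ) : ℂ) * (2 * Complex.cos (↑r * ↑t)) := by ring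
    rw [e3, Complex.two_cos]
    ring
  rw [intervalIntegral.integral_congr hsum, intervalIntegral.integral_ofReal,
    intervalIntegral.integral_const_mul]
  push_cast
  ring

/-- For an EVEN test function `G`, Bombieri's archimedean term is `−2 W♯_ℝ(G)` — [CCM] (3.15),
«note the factor ½». [cite: ConnesConsaniMoscovici2025, §3 eq. (3.15), p. 7] -/
theorem weilArchTermBombieri_of_even {G : ℝ → ℂ} (hG : ∀ t, G (-t) = G t) :
    weilArchTermBombieri G = -2 * psiSharpArch G := by
  unfold weilArchTermBombieri psiSharpArch
  have hint : (fun t : ℝ ↦ ((Real.exp (t / 2) : ℂ) * (G t + G (-t)) - 2 * G 0) / (2 * Real.sinh t : ℂ)) =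
      fun t : ℝ ↦ (2 : ℂ) * (((Real.exp (t / 2) : ℂ) * G t - G 0) /
        ((Real.exp t - Real.exp (-t) : ℝ) : ℂ)) := by
    funext t
    rw [hG, Real.sinh_eq]
    push_cast
    ring
  rw [hint, integral_const_mul]
  ring

/-- **`∫_ℝ C_{mn}(r) dr = π q(U_m,U_n)(0)`** — Fourier inversion at `0` for the even kernel `G`
(`Ĝ(½ + ir) = 2C_{mn}(r)`, `G` continuous and compactly supported, `C_{mn} ∈ L¹`); the step that
matches the `−g(0) log π` of the digamma form with the `−log π` inside `h₊`. [cite: Groskin2026, Lemma 2.1 (p. 4), «h₊ is the density of W_ℝ»] -/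
theorem integral_kernelCos {L : ℝ} (hL : 0 < L) (m n : ℤ) :
    ∫ r : ℝ, (∫ y in (0 : ℝ)..L, qKer L m n y * Real.cos (r * y)) = π * qKer L m n 0 := by
  set C : ℝ → ℝ := fun r ↦ ∫ y in (0 : ℝ)..L, qKer L m n y * Real.cos (r * y) with hCdef
  have hGc := continuous_symAutocorr hL m n
  have hGi : Integrable (symAutocorr L m n) :=
    hGc.integrable_of_hasCompactSupport (hasCompactSupport_symAutocorr hL m n)
  have hF : 𝓕 (symAutocorr L m n) = fun w : ℝ ↦ (2 : ℂ) * ((C (-(2 * π * w)) : ℝ) : ℂ) := by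
    funext w
    rw [Real.fourier_real_eq_integral_exp_smul, hCdef]
    simp only []
    rw [← weilMellin_symAutocorr hL m n (-(2 * π * w))]
    unfold weilMellin
    refine integral_congr_ae (Eventually.of_forall fun v ↦ ?_)
    beta_reduce
    rw [smul_eq_mul, mul_comm]
    congr 1
    push_cast
    ring_nf
  have hCi : Integrable C := integrable_kernelCos hL m n
  have hFi : Integrable (𝓕 (symAutocorr L m n)) := by
    have hr : Integrable fun w : ℝ ↦ C (-(2 * π * w)) := by
      have h1 := hCi.comp_mul_left' (R := -(2 * π)) (neg_ne_zero.2 (by positivity))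
      refine h1.congr (Eventually.of_forall fun w ↦ ?_)
      simp only [neg_mul]
    rw [hF]
    exact (hr.ofReal (𝕜 := ℂ)).const_mul (2 : ℂ)
  have h := hGi.fourierInv_fourier_eq hFi (hGc.continuousAt (x := 0))
  rw [Real.fourierInv_eq', hF] at h
  simp only [inner_zero_right, mul_zero, Complex.ofReal_zero, zero_mul, Complex.exp_zero,
    one_smul] at h
  rw [integral_const_mul, integral_complex_ofReal,
    symAutocorr_eq_ofReal_qKer hL m n ⟨le_rfl, hL.le⟩] at h
  have hsub : (∫ v : ℝ, C (-(2 * π * v))) = (1 / (2 * π)) * ∫ v, C v := by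
    have h1 := Measure.integral_comp_mul_left C (-(2 * π))
    simp only [neg_mul] at h1
    rw [h1, smul_eq_mul, inv_neg, abs_neg, abs_inv, abs_of_pos (by positivity : (0 : ℝ) < 2 * π),
      one_div]
  rw [hsub] at h
  have h' : 2 * ((1 / (2 * π)) * ∫ v, C v) = qKer L m n 0 := by exact_mod_cast h
  have hπ : (π : ℝ) ≠ 0 := Real.pi_ne_zero
  calc (∫ v, C v) = π * (2 * ((1 / (2 * π)) * ∫ v, C v)) := by field_simp
    _ = π * qKer L m n 0 := by rw [h']

/-- **(V) The value of the limit**: `(1/2π)∫_ℝ h₊(r) C_{mn}(r) dr = −W♯_ℝ(q(U_m,U_n))` with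
`W♯_ℝ` = [CCM] (3.15) in the form (4.4) (the tree's `archSharp L`). Assembly: `(1/2π)∫ h₊ C_{mn} =
½ W_∞(G)` (digamma form, `∫ C_{mn} = π G(0)`) `= ½ W_∞^{Bombieri}(G)` (Lipschitz `G`, Bombieri (2.8))
`= −W♯_ℝ(G)` (even `G`, (3.15)) `= −archSharp L (qKer L m n)` ([CCM] (4.4), tree
`psiSharpArch_symAutocorr`). [cite: Groskin2026, Lemma 2.1 (p. 4), «h₊ is the density of W_ℝ in [10, Sec. 3] and [8, Eq. (153)]»] -/
theorem integral_hPlus_kernelCos {L : ℝ} (hL : 0 < L) (m n : ℤ) :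
    (1 / (2 * π)) * ∫ r : ℝ, hPlus r * (∫ y in (0 : ℝ)..L, qKer L m n y * Real.cos (r * y)) =
      -archSharp L (qKer L m n) := by
  set C : ℝ → ℝ := fun r ↦ ∫ y in (0 : ℝ)..L, qKer L m n y * Real.cos (r * y) with hCdef
  have hGc : Continuous (symAutocorr L m n) := continuous_symAutocorr hL m n
  have hGs : HasCompactSupport (symAutocorr L m n) := hasCompactSupport_symAutocorr hL m n
  obtain ⟨K, hK⟩ := exists_lipschitzWith_symAutocorr hL m n
  have hψC : Integrable fun t : ℝ ↦ reDigammaQuarter t * C t :=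
    integrable_reDigammaQuarter_mul_kernelCos hL m n
  have hCi : Integrable C := integrable_kernelCos hL m n
  have hfun : (fun t : ℝ ↦ weilMellin (symAutocorr L m n) (1 / 2 + t * I) *
      ((Complex.digamma (1 / 4 + t / 2 * I)).re : ℂ)) =
      fun t : ℝ ↦ (2 : ℂ) * (((reDigammaQuarter t * C t : ℝ)) : ℂ) := by
    funext t
    rw [weilMellin_symAutocorr hL m n t, hCdef]
    simp only [reDigammaQuarter]
    push_cast
    ring
  have hA : Integrable fun t : ℝ ↦ weilMellin (symAutocorr L m n) (1 / 2 + t * I) *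
      ((Complex.digamma (1 / 4 + t / 2 * I)).re : ℂ) := by
    rw [hfun]
    exact (hψC.ofReal (𝕜 := ℂ)).const_mul (2 : ℂ)
  have hBD : weilArchTermBombieri (symAutocorr L m n) = weilArchTerm (symAutocorr L m n) :=
    weilArchTermBombieri_eq_weilArchTerm_of_lipschitz hGc hGs hK hA
  have hEven : weilArchTermBombieri (symAutocorr L m n) = -2 * psiSharpArch (symAutocorr L m n) :=
    weilArchTermBombieri_of_even (symAutocorr_neg L m n)
  have hSharp : psiSharpArch (symAutocorr L m n) = ((archSharp L (qKer L m n) : ℝ) : ℂ) :=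
    psiSharpArch_symAutocorr hL m n
  have h0 : symAutocorr L m n 0 = ((qKer L m n 0 : ℝ) : ℂ) :=
    symAutocorr_eq_ofReal_qKer hL m n ⟨le_rfl, hL.le⟩
  have hFI : ∫ r : ℝ, C r = π * qKer L m n 0 := integral_kernelCos hL m n
  have hsplit : (∫ r : ℝ, hPlus r * C r) = (∫ r : ℝ, reDigammaQuarter r * C r) -
      Real.log π * ∫ r : ℝ, C r := by
    have e : (fun r : ℝ ↦ hPlus r * C r) = fun r : ℝ ↦ reDigammaQuarter r * C r - Real.log π * C r := by
      funext r; simp only [hPlus]; ring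
    rw [e, integral_sub hψC (hCi.const_mul _), integral_const_mul]
  have hπ : (π : ℝ) ≠ 0 := Real.pi_ne_zero
  -- the digamma form, computed
  have hW : weilArchTerm (symAutocorr L m n) =
      ((((1 / π) * ∫ r : ℝ, hPlus r * C r : ℝ)) : ℂ) := by
    rw [weilArchTerm_eq, hfun, integral_const_mul, integral_complex_ofReal, h0, hsplit, hFI]
    push_cast
    field_simp
  have hC : ((((1 / (2 * π)) * ∫ r : ℝ, hPlus r * C r : ℝ)) : ℂ) =
      ((-archSharp L (qKer L m n) : ℝ) : ℂ) := by
    have e : ((((1 / (2 * π)) * ∫ r : ℝ, hPlus r * C r : ℝ)) : ℂ) =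
        (1 / 2 : ℂ) * weilArchTerm (symAutocorr L m n) := by
      rw [hW]; push_cast; field_simp
    rw [e, ← hBD, hEven, hSharp]
    push_cast
    ring
  exact_mod_cast hC

end ArchBlock

/-! ## §5 The discharge -/

/-- **[Gr26] Lemma 2.1, archimedean block — DISCHARGED**: for `c > 1`, `N`, `m, n ∈ I_N`,
`(Q_arch,T)_{mn} → −W♯_ℝ(q(U_m,U_n))` as `T → ∞` (`W♯_ℝ` in the form [CCM] (4.4), the tree's
`ConnesConsani2025.archSharp (log c)`), i.e. `Q_arch,∞ = lim_T Q_arch,T` exists entrywise and is the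
archimedean block of the CCM Galerkin matrix `(−W♯_ℝ(q(U_m,U_n)))_{m,n}`. With rh-lit-frontier-1's
`cutoffFreeMatrix_eq_truncatedWeilMatrix` this closes the identification `Q_∞^{(c,N)} =` the tree's
`truncatedWeilMatrix (log c) N`. [cite: Groskin2026, Lemma 2.1 (p. 4)] -/
theorem lemma_2_1_arch_holds : lemma_2_1_arch := by
  intro c hc N m n
  have h := ArchBlock.tendsto_archMatrix hc N m n
  rwa [ArchBlock.integral_hPlus_kernelCos (Real.log_pos hc)] at h

end Groskin2026

end Literature.NumberTheory.LFunctions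

end
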